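import Literature.MathematicalPhysics.QuantumManyBody.PeriodicBoseGasScattering
import Mathlib.Analysis.SpecialFunctions.Integrals.Basic
import HarnessLib

/-!
# Route `BECDyadicChaining` — crux `DyadicCoherenceDefect`, helper for stub U
# (`stub_freeDirichletEnergy`): the one-dimensional profile

Supports (does not close) stmt-AtomisticToContinuum-13192. The sharp upper bound
`E₀(v = 0, N, L) ≤ 3Nπ²/L²` on the free Dirichlet ground-state energy needs `C¹` approximants of
`sin(π t/L)` on `(0, L)` (the sine itself is not `C¹` across the walls once extended by `0`) whose
Rayleigh quotients tend to `(π/L)²`. Here, for `ω = π/L` and the smooth plateau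
`χ_ε(t) = σ_ε(t) σ_ε(L - t)` (`σ_ε = smoothStep ε ε`: `0` on `(-∞, ε]`, `1` on `[2ε, ∞)`,
monotone), the profile `g = sin(ω·) χ_ε` satisfies the IMS-type identity
`∫₀ᴸ g'² = ω² ∫₀ᴸ g² + ∫₀ᴸ sin²(ω·) χ_ε'²` (the difference of the two sides is the integral of
the derivative of `sin(ω·) ω cos(ω·) χ_ε²`, which vanishes at `0` and `L`), the localisation
error is `≤ 16 ω² M ε` (`|σ_ε'| ≤ M/ε` on a layer where `sin² ≤ 4ω²ε²`, `σ_ε' ≥ 0`,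
`∫₀ᴸ σ_ε' = 1`) and `∫₀ᴸ g² ≥ L/2 - 8ω²ε²L` (`profile_core`); hence, for `ε` small and after
normalisation, `∫₀ᴸ G² = 1`, `∫₀ᴸ G'² ≤ (π/L)² + δ` (`exists_profile`). No new definitions;
`[folklore]` throughout.
-/

noncomputable section

namespace Summit.AtomisticToContinuum.BoseEinsteinCondensation.Cruxes.DyadicCoherenceDefect.Birth

namespace FreeDirichletEnergy

open MeasureTheory Set intervalIntegral
open Literature.MathematicalPhysics.QuantumManyBody.BoseGas

/-! ### One dimension: the plateau-cut sine profile -/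

/-- The smooth step is monotone, so its derivative is nonnegative. [folklore] -/
theorem deriv_smoothStep_nonneg {r₀ θ : ℝ} (hθ : 0 < θ) (r : ℝ) :
    0 ≤ deriv (smoothStep r₀ θ) r := by
  have hmono : Monotone (smoothStep r₀ θ) := fun a b hab => by
    unfold smoothStep
    exact Real.smoothTransition.monotone (div_le_div_of_nonneg_right (by linarith) hθ.le)
  exact hmono.deriv_nonneg

/-- **The layer bound.** With `σ = smoothStep ε ε` (`σ' = 0` off `[ε, 2ε]`, `|σ'| ≤ M/ε` on it,
`σ' ≥ 0`) and `|sin(ωt)| ≤ ωt ≤ 2ωε` on the layer: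
`sin²(ωt) σ'(t)² ≤ 4ω²Mε σ'(t)` for every `t`. [folklore] -/
theorem sin_sq_mul_deriv_sq_le {ε M ω : ℝ} (hε : 0 < ε)
    (hM : ∀ y ∈ Icc (0 : ℝ) 1, |deriv Real.smoothTransition y| ≤ M) (hω : 0 ≤ ω) (t : ℝ) :
    Real.sin (ω * t) ^ 2 * deriv (smoothStep ε ε) t ^ 2 ≤
      4 * ω ^ 2 * M * ε * deriv (smoothStep ε ε) t := by
  have hσ' := deriv_smoothStep_nonneg (r₀ := ε) hε t
  rcases le_or_gt t ε with ht | ht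
  · rw [deriv_smoothStep_of_le hε ht]; simp
  rcases le_or_gt (ε + ε) t with ht2 | ht2
  · rw [deriv_smoothStep_of_ge hε ht2]; simp
  have hderiv : |deriv (smoothStep ε ε) t| ≤ M / ε :=
    abs_deriv_smoothStep_le hε hM ⟨ht.le, ht2.le⟩
  have ht0 : 0 ≤ t := by linarith
  have hsin : Real.sin (ω * t) ^ 2 ≤ (2 * ω * ε) ^ 2 := by
    have h1 : |Real.sin (ω * t)| ≤ |ω * t| := Real.abs_sin_le_abs
    have h2 : |ω * t| ≤ 2 * ω * ε := by
      rw [abs_of_nonneg (mul_nonneg hω ht0)]; nlinarith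
    have h3 : |Real.sin (ω * t)| ≤ |2 * ω * ε| := (h1.trans h2).trans (le_abs_self _)
    exact sq_le_sq.2 h3
  have hd : deriv (smoothStep ε ε) t ^ 2 ≤ M / ε * deriv (smoothStep ε ε) t := by
    rw [sq]; exact mul_le_mul_of_nonneg_right ((le_abs_self _).trans hderiv) hσ'
  calc Real.sin (ω * t) ^ 2 * deriv (smoothStep ε ε) t ^ 2
      ≤ (2 * ω * ε) ^ 2 * (M / ε * deriv (smoothStep ε ε) t) :=
        mul_le_mul hsin hd (sq_nonneg _) (sq_nonneg _)
    _ = 4 * ω ^ 2 * M * ε * deriv (smoothStep ε ε) t := by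
        field_simp
        ring

/-- `sin²(ωu) ≤ 4ω²ε²` for `0 ≤ u ≤ 2ε` (from `|sin x| ≤ |x|`). [folklore] -/
theorem sin_sq_le_of_le {ε ω u : ℝ} (hω : 0 ≤ ω) (hu0 : 0 ≤ u) (hu : u ≤ 2 * ε) :
    Real.sin (ω * u) ^ 2 ≤ 4 * ω ^ 2 * ε ^ 2 := by
  have h1 : |Real.sin (ω * u)| ≤ |ω * u| := Real.abs_sin_le_abs
  have h2 : |ω * u| ≤ 2 * ω * ε := by
    rw [abs_of_nonneg (mul_nonneg hω hu0)]; nlinarith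
  have h3 : |Real.sin (ω * u)| ≤ |2 * ω * ε| := (h1.trans h2).trans (le_abs_self _)
  calc Real.sin (ω * u) ^ 2 ≤ (2 * ω * ε) ^ 2 := sq_le_sq.2 h3
    _ = 4 * ω ^ 2 * ε ^ 2 := by ring


/-- **The one-dimensional profile** `g(t) = sin(ωt) σ(t) σ(L - t)` (`ω = π/L`, `σ = smoothStep ε ε`,
`0 < 2ε ≤ L`, `|ST'| ≤ M` on `[0,1]`): `g` is `C¹` with derivative `g'`, both vanish off `(0, L)`,
`∫₀ᴸ g'² ≤ ω² ∫₀ᴸ g² + 16ω²Mε` (IMS identity: `g'² - ω²g² - sin²(ω·)χ'²` is the derivative of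
`sin(ω·) ω cos(ω·) χ²`, `χ = σ σ(L - ·)`, which vanishes at `0` and `L`; plus the layer bound and
`∫₀ᴸ σ' = 1`) and `∫₀ᴸ g² ≥ L/2 - 8ω²ε²L` (`χ = 1` except on two layers of width `2ε` where
`sin² ≤ 4ω²ε²`, and `∫₀ᴸ sin²(ω·) = L/2`). [folklore] -/
theorem profile_core {L ε M : ℝ} (hL : 0 < L) (hε : 0 < ε) (h2ε : 2 * ε ≤ L)
    (hM : ∀ y ∈ Icc (0 : ℝ) 1, |deriv Real.smoothTransition y| ≤ M)
    (ω : ℝ) (hω : ω = Real.pi / L) (σ σ' g g' : ℝ → ℝ) (hσ : σ = smoothStep ε ε)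
    (hσ' : σ' = deriv σ) (hg : g = fun t => Real.sin (ω * t) * (σ t * σ (L - t)))
    (hg' : g' = fun t => ω * Real.cos (ω * t) * (σ t * σ (L - t)) +
      Real.sin (ω * t) * (σ' t * σ (L - t) - σ t * σ' (L - t))) :
    ContDiff ℝ 1 g ∧ (∀ t, HasDerivAt g (g' t) t) ∧
    (∀ t, t ∉ Ioo 0 L → g t = 0 ∧ g' t = 0) ∧
    (∫ t in 0..L, g' t ^ 2) ≤ ω ^ 2 * (∫ t in 0..L, g t ^ 2) + 16 * ω ^ 2 * M * ε ∧
    L / 2 - 8 * ω ^ 2 * ε ^ 2 * L ≤ ∫ t in 0..L, g t ^ 2 := by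
  have hω0 : 0 < ω := by rw [hω]; positivity
  have hωL : ω * L = Real.pi := by rw [hω]; field_simp
  -- the step `σ`
  have hσC : ContDiff ℝ 1 σ := by rw [hσ]; exact smoothStep_contDiff ε ε
  have hσd : ∀ t, HasDerivAt σ (σ' t) t := fun t => by
    rw [hσ']; exact (hσC.differentiable one_ne_zero t).hasDerivAt
  have hσc : Continuous σ := hσC.continuous
  have hσ'c : Continuous σ' := by rw [hσ']; exact hσC.continuous_deriv le_rfl
  have hσ0 : ∀ t, t ≤ ε → σ t = 0 := fun t ht => by rw [hσ]; exact smoothStep_of_le hε ht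
  have hσ1 : ∀ t, 2 * ε ≤ t → σ t = 1 := fun t ht => by
    rw [hσ]; exact smoothStep_of_ge hε (by linarith)
  have hσ'0 : ∀ t, t ≤ ε → σ' t = 0 := fun t ht => by
    rw [hσ', hσ]; exact deriv_smoothStep_of_le hε ht
  have hσnn : ∀ t, 0 ≤ σ t := fun t => by rw [hσ]; exact smoothStep_nonneg t
  have hσle : ∀ t, σ t ≤ 1 := fun t => by rw [hσ]; exact smoothStep_le_one t
  have hkey : ∀ t, Real.sin (ω * t) ^ 2 * σ' t ^ 2 ≤ 4 * ω ^ 2 * M * ε * σ' t := fun t => by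
    rw [hσ', hσ]; exact sin_sq_mul_deriv_sq_le hε hM hω0.le t
  have hsym : ∀ t, Real.sin (ω * t) = Real.sin (ω * (L - t)) := fun t => by
    rw [mul_sub, hωL, Real.sin_pi_sub]
  -- derivatives
  have hsd : ∀ t, HasDerivAt (fun t => Real.sin (ω * t)) (ω * Real.cos (ω * t)) t := fun t =>
    (((hasDerivAt_id' t).const_mul ω).sin).congr_deriv (by ring)
  have hcd : ∀ t, HasDerivAt (fun t => ω * Real.cos (ω * t)) (-(ω ^ 2 * Real.sin (ω * t))) t :=
    fun t => ((((hasDerivAt_id' t).const_mul ω).cos).const_mul ω).congr_deriv (by ring)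
  have hχd : ∀ t, HasDerivAt (fun t => σ t * σ (L - t))
      (σ' t * σ (L - t) + σ t * -σ' (L - t)) t := fun t => by
    have h1 : HasDerivAt (fun t => σ (L - t)) (-σ' (L - t)) t :=
      ((hσd (L - t)).comp t ((hasDerivAt_id' t).const_sub L)).congr_deriv (by ring)
    exact (hσd t).mul h1
  have hgd : ∀ t, HasDerivAt g (g' t) t := fun t => by
    simp only [hg, hg']
    exact ((hsd t).mul (hχd t)).congr_deriv (by ring)
  have hgC : ContDiff ℝ 1 g := by
    rw [hg]
    exact (Real.contDiff_sin.comp (contDiff_const.mul contDiff_id)).mul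
      (hσC.mul (hσC.comp (contDiff_const.sub contDiff_id)))
  -- support
  have hoff : ∀ t, t ∉ Ioo 0 L → g t = 0 ∧ g' t = 0 := by
    intro t ht
    simp only [mem_Ioo, not_and_or, not_lt] at ht
    simp only [hg, hg']
    rcases ht with ht | ht
    · have h1 : σ t = 0 := hσ0 t (ht.trans hε.le)
      have h2 : σ' t = 0 := hσ'0 t (ht.trans hε.le)
      simp [h1, h2]
    · have h1 : σ (L - t) = 0 := hσ0 _ (by linarith)
      have h2 : σ' (L - t) = 0 := hσ'0 _ (by linarith)
      simp [h1, h2]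
  refine ⟨hgC, hgd, hoff, ?_, ?_⟩
  · -- the IMS identity and the layer bound
    set F : ℝ → ℝ := fun t => Real.sin (ω * t) * (ω * Real.cos (ω * t)) * (σ t * σ (L - t)) *
      (σ t * σ (L - t)) with hF
    set F' : ℝ → ℝ := fun t => ω ^ 2 * Real.cos (ω * t) ^ 2 * (σ t * σ (L - t)) ^ 2 -
      ω ^ 2 * Real.sin (ω * t) ^ 2 * (σ t * σ (L - t)) ^ 2 +
      2 * ω * Real.sin (ω * t) * Real.cos (ω * t) * (σ t * σ (L - t)) *
        (σ' t * σ (L - t) - σ t * σ' (L - t)) with hF'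
    have hFd : ∀ t, HasDerivAt F (F' t) t := fun t =>
      ((((hsd t).mul (hcd t)).mul (hχd t)).mul (hχd t)).congr_deriv (by
        simp only [hF', Pi.mul_apply]; ring)
    have hF'c : Continuous F' := by
      have := hσc; have := hσ'c
      simp only [hF']
      fun_prop
    have hg'c : Continuous g' := by
      have := hσc; have := hσ'c
      rw [hg']
      fun_prop
    have hgc : Continuous g := hgC.continuous
    have hEc : Continuous fun t =>
        Real.sin (ω * t) ^ 2 * (σ' t * σ (L - t) - σ t * σ' (L - t)) ^ 2 := by
      have := hσc; have := hσ'c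
      fun_prop
    have hpt : ∀ t, g' t ^ 2 = F' t + ω ^ 2 * g t ^ 2 +
        Real.sin (ω * t) ^ 2 * (σ' t * σ (L - t) - σ t * σ' (L - t)) ^ 2 := fun t => by
      simp only [hg, hg', hF']; ring
    have hFint : ∫ t in 0..L, F' t = 0 := by
      rw [integral_eq_sub_of_hasDerivAt (fun t _ => hFd t) (hF'c.intervalIntegrable _ _)]
      simp [hF, hσ0 0 hε.le]
    have hA : ∫ t in 0..L, g' t ^ 2 = ω ^ 2 * (∫ t in 0..L, g t ^ 2) +
        ∫ t in 0..L, Real.sin (ω * t) ^ 2 * (σ' t * σ (L - t) - σ t * σ' (L - t)) ^ 2 := by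
      simp_rw [hpt]
      have i1 : IntervalIntegrable (fun t => F' t + ω ^ 2 * g t ^ 2) volume 0 L :=
        (by fun_prop : Continuous fun t => F' t + ω ^ 2 * g t ^ 2).intervalIntegrable _ _
      have i2 : IntervalIntegrable (fun t => ω ^ 2 * g t ^ 2) volume 0 L :=
        (by fun_prop : Continuous fun t => ω ^ 2 * g t ^ 2).intervalIntegrable _ _
      rw [integral_add i1 (hEc.intervalIntegrable _ _),
        integral_add (hF'c.intervalIntegrable _ _) i2, hFint, zero_add,
        intervalIntegral.integral_const_mul]
    -- the layer bound
    have hpt2 : ∀ t, Real.sin (ω * t) ^ 2 * (σ' t * σ (L - t) - σ t * σ' (L - t)) ^ 2 ≤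
        8 * ω ^ 2 * M * ε * (σ' t + σ' (L - t)) := by
      intro t
      have h1 := hkey t
      have h2 : Real.sin (ω * t) ^ 2 * σ' (L - t) ^ 2 ≤ 4 * ω ^ 2 * M * ε * σ' (L - t) := by
        rw [hsym t]; exact hkey (L - t)
      have hsq1 : σ (L - t) ^ 2 ≤ 1 := pow_le_one₀ (hσnn _) (hσle _)
      have hsq2 : σ t ^ 2 ≤ 1 := pow_le_one₀ (hσnn _) (hσle _)
      have e1 : Real.sin (ω * t) ^ 2 * σ' t ^ 2 * σ (L - t) ^ 2 ≤ 4 * ω ^ 2 * M * ε * σ' t :=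
        (mul_le_of_le_one_right (by positivity) hsq1).trans h1
      have e2 : Real.sin (ω * t) ^ 2 * σ t ^ 2 * σ' (L - t) ^ 2 ≤
          4 * ω ^ 2 * M * ε * σ' (L - t) := by
        calc _ = Real.sin (ω * t) ^ 2 * σ' (L - t) ^ 2 * σ t ^ 2 := by ring
          _ ≤ Real.sin (ω * t) ^ 2 * σ' (L - t) ^ 2 := mul_le_of_le_one_right (by positivity) hsq2
          _ ≤ _ := h2
      have e3 : (σ' t * σ (L - t) - σ t * σ' (L - t)) ^ 2 ≤
          2 * (σ' t * σ (L - t)) ^ 2 + 2 * (σ t * σ' (L - t)) ^ 2 := by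
        nlinarith [sq_nonneg (σ' t * σ (L - t) + σ t * σ' (L - t))]
      calc Real.sin (ω * t) ^ 2 * (σ' t * σ (L - t) - σ t * σ' (L - t)) ^ 2
          ≤ Real.sin (ω * t) ^ 2 * (2 * (σ' t * σ (L - t)) ^ 2 + 2 * (σ t * σ' (L - t)) ^ 2) :=
            mul_le_mul_of_nonneg_left e3 (sq_nonneg _)
        _ = 2 * (Real.sin (ω * t) ^ 2 * σ' t ^ 2 * σ (L - t) ^ 2) +
            2 * (Real.sin (ω * t) ^ 2 * σ t ^ 2 * σ' (L - t) ^ 2) := by ring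
        _ ≤ 2 * (4 * ω ^ 2 * M * ε * σ' t) + 2 * (4 * ω ^ 2 * M * ε * σ' (L - t)) := by
            gcongr
        _ = 8 * ω ^ 2 * M * ε * (σ' t + σ' (L - t)) := by ring
    have hσint : ∫ t in 0..L, σ' t = 1 := by
      rw [integral_eq_sub_of_hasDerivAt (fun t _ => hσd t) (hσ'c.intervalIntegrable _ _),
        hσ1 L h2ε, hσ0 0 hε.le]
      norm_num
    have hσint' : ∫ t in 0..L, σ' (L - t) = 1 := by
      rw [intervalIntegral.integral_comp_sub_left σ' L]
      simp only [sub_self, sub_zero]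
      exact hσint
    have hE : ∫ t in 0..L, Real.sin (ω * t) ^ 2 * (σ' t * σ (L - t) - σ t * σ' (L - t)) ^ 2 ≤
        16 * ω ^ 2 * M * ε := by
      have hRc : Continuous fun t => 8 * ω ^ 2 * M * ε * (σ' t + σ' (L - t)) := by
        have := hσ'c
        fun_prop
      calc ∫ t in 0..L, Real.sin (ω * t) ^ 2 * (σ' t * σ (L - t) - σ t * σ' (L - t)) ^ 2
          ≤ ∫ t in 0..L, 8 * ω ^ 2 * M * ε * (σ' t + σ' (L - t)) :=
            integral_mono_on hL.le (hEc.intervalIntegrable _ _) (hRc.intervalIntegrable _ _)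
              fun t _ => hpt2 t
        _ = 8 * ω ^ 2 * M * ε * ((∫ t in 0..L, σ' t) + ∫ t in 0..L, σ' (L - t)) := by
            rw [intervalIntegral.integral_const_mul, integral_add (hσ'c.intervalIntegrable _ _)
              ((by fun_prop : Continuous fun t => σ' (L - t)).intervalIntegrable _ _)]
        _ = 16 * ω ^ 2 * M * ε := by rw [hσint, hσint']; ring
    rw [hA]
    gcongr
  · -- the mass from below
    have hgc : Continuous g := hgC.continuous
    have hsinInt : ∫ t in 0..L, Real.sin (ω * t) ^ 2 = L / 2 := by
      rw [intervalIntegral.integral_comp_mul_left (fun x => Real.sin x ^ 2) hω0.ne', mul_zero, hωL,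
        integral_sin_sq]
      simp only [Real.sin_zero, Real.cos_zero, Real.sin_pi, Real.cos_pi, zero_mul, sub_zero,
        zero_add, smul_eq_mul]
      rw [hω]
      field_simp
    have hpt3 : ∀ t ∈ Icc 0 L, Real.sin (ω * t) ^ 2 - 8 * ω ^ 2 * ε ^ 2 ≤ g t ^ 2 := by
      intro t ht
      simp only [hg]
      have ha0 : 0 ≤ σ t := hσnn t
      have ha1 : σ t ≤ 1 := hσle t
      have hb0 : 0 ≤ σ (L - t) := hσnn _
      have hb1 : σ (L - t) ≤ 1 := hσle _
      have e1 : Real.sin (ω * t) ^ 2 * (1 - σ t ^ 2) ≤ 4 * ω ^ 2 * ε ^ 2 := by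
        rcases le_or_gt (2 * ε) t with h2 | h2
        · rw [hσ1 t h2]; simp only [one_pow, sub_self, mul_zero]; positivity
        · calc _ ≤ Real.sin (ω * t) ^ 2 * 1 := by gcongr; nlinarith
            _ ≤ 4 * ω ^ 2 * ε ^ 2 := by
                rw [mul_one]; exact sin_sq_le_of_le hω0.le ht.1 h2.le
      have e2 : Real.sin (ω * t) ^ 2 * (1 - σ (L - t) ^ 2) ≤ 4 * ω ^ 2 * ε ^ 2 := by
        rcases le_or_gt (2 * ε) (L - t) with h2 | h2
        · rw [hσ1 _ h2]; simp only [one_pow, sub_self, mul_zero]; positivity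
        · rw [hsym t]
          calc _ ≤ Real.sin (ω * (L - t)) ^ 2 * 1 := by gcongr; nlinarith
            _ ≤ 4 * ω ^ 2 * ε ^ 2 := by
                rw [mul_one]; exact sin_sq_le_of_le hω0.le (by linarith [ht.2]) h2.le
      have e3 : Real.sin (ω * t) ^ 2 * σ t ^ 2 * (1 - σ (L - t) ^ 2) ≤
          Real.sin (ω * t) ^ 2 * (1 - σ (L - t) ^ 2) := by
        have hsq : σ t ^ 2 ≤ 1 := pow_le_one₀ ha0 ha1
        have h0 : 0 ≤ 1 - σ (L - t) ^ 2 := by nlinarith [pow_le_one₀ (n := 2) hb0 hb1]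
        calc _ = Real.sin (ω * t) ^ 2 * (1 - σ (L - t) ^ 2) * σ t ^ 2 := by ring
          _ ≤ Real.sin (ω * t) ^ 2 * (1 - σ (L - t) ^ 2) :=
              mul_le_of_le_one_right (by positivity) hsq
      nlinarith [e1, e2, e3]
    have hsc : Continuous fun t => Real.sin (ω * t) ^ 2 := by fun_prop
    calc L / 2 - 8 * ω ^ 2 * ε ^ 2 * L
        = ∫ t in 0..L, (Real.sin (ω * t) ^ 2 - 8 * ω ^ 2 * ε ^ 2) := by
          rw [integral_sub (hsc.intervalIntegrable _ _) intervalIntegrable_const, hsinInt,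
            intervalIntegral.integral_const, smul_eq_mul]
          ring
      _ ≤ ∫ t in 0..L, g t ^ 2 :=
          integral_mono_on hL.le ((by fun_prop : Continuous fun t =>
            Real.sin (ω * t) ^ 2 - 8 * ω ^ 2 * ε ^ 2).intervalIntegrable _ _)
            ((hgc.pow 2).intervalIntegrable _ _) hpt3


/-- **A normalised `C¹` profile on `(0, L)` with Rayleigh quotient at most `(π/L)² + δ`**: for every
`δ > 0` there is `G ∈ C¹(ℝ)`, vanishing with its derivative off `(0, L)`, with `∫₀ᴸ G² = 1` and
`∫₀ᴸ G'² ≤ (π/L)² + δ` (the profile of `profile_core` with layers of width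
`ε = min(L/24, δL/(64ω²(M+1)))`, normalised). [folklore] -/
theorem exists_profile {L δ : ℝ} (hL : 0 < L) (hδ : 0 < δ) :
    ∃ G : ℝ → ℝ, ContDiff ℝ 1 G ∧ (∀ t, t ∉ Ioo 0 L → G t = 0) ∧
      (∀ t, t ∉ Ioo 0 L → deriv G t = 0) ∧ (∫ t in 0..L, G t ^ 2 = 1) ∧
      ∫ t in 0..L, deriv G t ^ 2 ≤ (Real.pi / L) ^ 2 + δ := by
  obtain ⟨M, hM0, hM⟩ := exists_bound_deriv_smoothTransition
  set ω : ℝ := Real.pi / L with hω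
  have hω0 : 0 < ω := by positivity
  have hωL : ω * L = Real.pi := by rw [hω]; field_simp
  -- the width of the layers
  set ε : ℝ := min (L / 24) (δ * L / (64 * ω ^ 2 * (M + 1))) with hε
  have hε0 : 0 < ε := lt_min (by positivity) (by positivity)
  have hεL : ε ≤ L / 24 := min_le_left _ _
  have hεδ : ε ≤ δ * L / (64 * ω ^ 2 * (M + 1)) := min_le_right _ _
  have h2ε : 2 * ε ≤ L := by linarith
  set σ : ℝ → ℝ := smoothStep ε ε with hσ
  set σ' : ℝ → ℝ := deriv σ with hσ'
  set g : ℝ → ℝ := fun t => Real.sin (ω * t) * (σ t * σ (L - t)) with hg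
  set g' : ℝ → ℝ := fun t => ω * Real.cos (ω * t) * (σ t * σ (L - t)) +
    Real.sin (ω * t) * (σ' t * σ (L - t) - σ t * σ' (L - t)) with hg'
  obtain ⟨hgC, hgd, hoff, hA, hB⟩ := profile_core hL hε0 h2ε hM ω hω σ σ' g g' hσ hσ' hg hg'
  -- the mass is at least `L/4`
  have h32 : 32 * (ω * ε) ^ 2 ≤ 1 := by
    have hωε : ω * ε ≤ Real.pi / 24 := by
      calc ω * ε ≤ ω * (L / 24) := by gcongr
        _ = Real.pi / 24 := by rw [← hωL]; ring
    have hωε4 : ω * ε ≤ 4 / 24 := hωε.trans (by linarith [Real.pi_le_four])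
    have hωε0 : 0 ≤ ω * ε := by positivity
    nlinarith
  have hB' : L / 4 ≤ ∫ t in 0..L, g t ^ 2 := by
    have : 8 * ω ^ 2 * ε ^ 2 * L ≤ L / 4 := by nlinarith
    linarith
  have hBpos : 0 < ∫ t in 0..L, g t ^ 2 := by linarith
  -- the localisation error is at most `δ` times the mass
  have hE' : 16 * ω ^ 2 * M * ε ≤ δ * ∫ t in 0..L, g t ^ 2 := by
    calc 16 * ω ^ 2 * M * ε ≤ 16 * ω ^ 2 * (M + 1) * ε := by gcongr; linarith
      _ ≤ 16 * ω ^ 2 * (M + 1) * (δ * L / (64 * ω ^ 2 * (M + 1))) := by gcongr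
      _ = δ * (L / 4) := by field_simp; ring
      _ ≤ δ * ∫ t in 0..L, g t ^ 2 := by gcongr
  have hA' : ∫ t in 0..L, g' t ^ 2 ≤ (ω ^ 2 + δ) * ∫ t in 0..L, g t ^ 2 := by
    rw [add_mul]; linarith
  -- normalise
  set B : ℝ := ∫ t in 0..L, g t ^ 2 with hBdef
  refine ⟨fun t => g t / Real.sqrt B, hgC.div_const _, fun t ht => ?_, fun t ht => ?_, ?_, ?_⟩
  · simp [(hoff t ht).1]
  · rw [deriv_div_const, (hgd t).deriv, (hoff t ht).2, zero_div]
  · have hsq : ∀ t, (g t / Real.sqrt B) ^ 2 = g t ^ 2 / B := fun t => by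
      rw [div_pow, Real.sq_sqrt hBpos.le]
    simp_rw [hsq]
    rw [intervalIntegral.integral_div, div_self hBpos.ne']
  · have hsq : ∀ t, deriv (fun t => g t / Real.sqrt B) t ^ 2 = g' t ^ 2 / B := fun t => by
      rw [deriv_div_const, (hgd t).deriv, div_pow, Real.sq_sqrt hBpos.le]
    simp_rw [hsq]
    rw [intervalIntegral.integral_div, div_le_iff₀ hBpos]
    exact hA'

end FreeDirichletEnergy

/-- **Helper sub-goal for stub U** (`stub_freeDirichletEnergy`): for every `L > 0`, `δ > 0` a
`C¹` profile `G` on `ℝ`, vanishing together with `G'` off `(0, L)`, with `∫₀ᴸ G² = 1` and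
`∫₀ᴸ G'² ≤ (π/L)² + δ` (`FreeDirichletEnergy.exists_profile`). [folklore] -/
theorem stub_freeDirichletProfile :
    ∀ (L δ : ℝ), 0 < L → 0 < δ → ∃ G : ℝ → ℝ, ContDiff ℝ 1 G ∧
      (∀ t, t ∉ Set.Ioo 0 L → G t = 0) ∧ (∀ t, t ∉ Set.Ioo 0 L → deriv G t = 0) ∧
      (∫ t in 0..L, G t ^ 2 = 1) ∧ ∫ t in 0..L, deriv G t ^ 2 ≤ (Real.pi / L) ^ 2 + δ :=
  fun _ _ hL hδ => FreeDirichletEnergy.exists_profile hL hδ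

end Summit.AtomisticToContinuum.BoseEinsteinCondensation.Cruxes.DyadicCoherenceDefect.Birth

end
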